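/-
Copyright: lit-balaban Phase-2 proof seat p34 (gen 20).  Statement-level skeleton of a published paper; no proof claims beyond what the
kernel checks below.
-/
import Literature.MathematicalPhysics.QuantumFieldTheory.BalabanImbrieJaffe1984to88.BIJ88NeumannPropagatorSmallFieldRegionSup
import Literature.MathematicalPhysics.QuantumFieldTheory.BalabanImbrieJaffe1984to88.BIJ85BiCentredAxialGauge
import Literature.MathematicalPhysics.QuantumFieldTheory.BalabanImbrieJaffe1984to88.BIJ88Sect2Statements

/-!
# [BalabanImbrieJaffe1988] p. 263 (2.30)/(2.31) WITH THEIR PRINTED LOCAL HYPOTHESIS (2.32)/(2.33) — **the [6] (1.10)-type decay of the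
# region Neumann propagators `G_k(Ω,u)` on EVERY `k`-block union `Ω` when the gauge field is smooth ONLY NEAR `Ω`** (plaquette smallness
# of `u` on the plaquettes based within `2L^k` of `Ω`, nothing assumed elsewhere), and the printed smoothness (2.32)
# `u = exp[ie_kη(A + ∂λ)]`, `|∂A| ≦ O(p(e_k))` near `Ω` (`BIJ88Sect2Statements.SmoothOn`) as the hypothesis — file B-I of the TAKING
# (kernel and operator VALUE members and the covariant-derivative KERNEL member; file B-II = the operator-form `D_u` member at deep bonds and
# the (1.9) Hölder member under the same local hypothesis)

T. Bałaban, J. Imbrie, A. Jaffe, *Effective action and cluster properties of the abelian Higgs model*, Commun. Math. Phys. **114** (1988)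
257–315 [BalabanImbrieJaffe1988], Sect. 2 p. 263 [PDF 7]: *"G_k(u; x₁, x₂) = Σ_α λ_α G_k(□_α, u; x₁, x₂) (2.27) as a convex combination of
Neumann propagators. … a straightforward application of the random walk expansion of [6] shows that |(G_{k,loc}(u)f)(x)| ≦
ce^{−c dist(suppt f,x)}‖f‖_∞, (2.30) |(G_{k,loc}(u)f − G_k(Ω,u)f)(x)| ≦ e^{−cr(e_k)}e^{−c dist(suppt f,x)}‖f‖_∞ for dist(x, Ω^c) ≧ O(r(e_k)).
(2.31) We assume that u is smooth in the □_α's entering the sum in (2.27); for (2.31) we assume smoothness throughout the subset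
Ω ⊂ T_η. This means that in a neighborhood of each □_α there exists an A, λ such that u = exp[ie_kη(A + ∂λ)] with |∂A|, |∂*A| ≦ O(p(e_k)).
(2.32) Here [(2.33)] is our logarithmic scale for small fields."* (reader's notes, NOT on the page: the display (2.33) defines the scale
`p(e_k)`, a positive power of `|log e_k|` as in [I]; below, "`u` smooth NEAR `Ω`" abbreviates the hypothesis (2.32) in the tree's currency —
plaquette smallness on the plaquettes based within `2L^k` of `Ω`); [I] = T. Bałaban, J. Imbrie, A. Jaffe, *Renormalization of the Higgs model: minimizers, propagators and the stability of mean field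
theory*, Commun. Math. Phys. **97** (1985) 299–329 [BalabanImbrieJaffe1985], §7.3 p. 326 [PDF 28]: *"The propagators arising from Δ_k(u_k)
… also satisfy the regularity and decay estimates of [7]. In order to remain within the framework of this reference, we remark that by change
of gauge u_k can be transformed in a local region Λ into a configuration of the form exp[ie_kηA], where A is smooth and small."*; [6] = [7]
of [I] = T. Bałaban, *Regularity and decay of lattice Green's functions*, Commun. Math. Phys. **89** (1983) 571–597 [Balaban1983RegularityDecay],
Theorem p. 573 [PDF 3], (1.10): *"|(G_k(Ω, A)f)(x)|, |(D^η_{A,μ}G_k(Ω, A)f)(x)| ≦ c₀ exp(−δ₀ dist(x, supp f))‖f‖_∞ (1.10)"*; the tree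
("axial") gauge of a box: T. Bałaban, *Averaging operations for lattice gauge theories*, Commun. Math. Phys. **98** (1985) 17–51
[Balaban1985Averaging], pp. 24–25.

statement-level skeleton of published theorems with citation tags; proofs where landed; nothing here is a claim about the Yang–Mills mass gap

PDFs held: `paper:balaban1988-cmp114-bij-abelian-higgs-effective-action` (journal page = PDF page + 256; p. 263 [PDF 7], text layer re-read this
session: the two sentences after (2.31) and the sentence after (2.33)); `paper:balaban1985-cmp97-bij-higgs-minimizers` (p. 326 [PDF 28]);
`paper:balaban1983-cmp89-regularity-decay` (p. 573 [PDF 3]).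

CITATION HEADER (lean-in-tree rule).  Part of the lit-balaban TYPED SKELETON (HOME `run/shared/lean/pub/lit-balaban/`), PHASE-2 proof seat
p34 gen 20 (unit `lit-balaban-p34-g20`; TAKING #2 line HOME/STATUS.md 2026-08-23T10:48Z; free-target protocol G.5-34(d)).  WHAT IS
REPRODUCED: located MEMBERS of rows **C2.Eq2.30** / **C2.Eq2.31** / **C2.Claim@263** and the first CONSUMER BY NAME of the definition row
**C2.Eq2.32** (`BIJ88Sect2Statements.SmoothOn`, owner r18): the tree's non-flat region-propagator members (p34 gens 16–18, p27, p30, p31, p29)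
all take the plaquette smallness of `u` ON THE WHOLE TORUS (`∀ p, ‖u(∂p) − 1‖ ≤ θ`) or [I]'s (7.3.1) on ALL unit plaquettes, whereas the print
assumes smoothness ONLY NEAR the region ((2.32): *"in a neighborhood of each □_α"*, *"throughout the subset Ω"*, (2.33) *"near □"*) — a
genuinely weaker hypothesis (a vortex in a hole of `Ω` is allowed).  This file states the [6] (1.10)-type VALUE members (kernel and operator
form) and the covariant-derivative KERNEL member of `G_k(Ω,u)` under plaquette smallness NEAR `Ω` ONLY, for EVERY `k`-block union, and under
the printed (2.32) itself.  No row is restated and no head changes.  USED BY NAME, never restated: p34 gen 16's `decay_kernel_smallField_region`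
/ `decay_covD_kernel_smallField_region` (`BIJ88NeumannPropagatorSmallFieldRegion`; their hypotheses are the BLOCK-LOCAL bondwise `(T, δ)`
conditions INSIDE `Ω` — nothing global), `holCK_congr` / `gBox_gaugeAct_apply` / `norm_covD_gBox_gaugeAct` (`BIJ88NeumannPropagatorSmallPlaquetteRegion`,
`BIJ88DeltaLoc234Torus`), p34 gen 18's `decay110_smallField_region_input` (`BIJ88NeumannPropagatorSmallFieldRegionSup`, `(T, δ)` inside `Ω`
only), p30's tree gauge `centredGaugeDir` with `gaugeAct_gaugeAtFn_castSite` / `dist1_axialFnPerm_bond_le` / `l1_lowPart_le_offTop` / `lift` /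
`castSite_lift` / `natAbs_valMinAbs_eq_cdist` (`BIJ85BiCentredAxialGauge`, `BIJ85CentredAxialGauge`), T4's `BoxPlaqSmall` / `pull` /
`hol_pull_plaqWord_of_lt/gt` (`T4AxialGaugeSmallField`), p11/p33's `holCK` / `blkIter` / `cornerIter` / `blockK` (`BIJ85BlockAveragesTorusK`),
`norm_holCK_sub_one_le` (`BIJ85HolonomyDeviation`), `supDist_le_of_blkIter_eq` (`BIJ85ScalarPropagatorDecay`), r18's `SmoothOn` / `starB`,
`LatticeFieldCalculus.curl` / `grad` / `curl_grad`.  Kind: theorems only (no definition, no `Prop`-valued fact).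

THE MATHEMATICS (why the local hypothesis suffices although local plaquette smallness does NOT extend to global smallness).  `G_k(Ω,u)` reads
`u` only on the bonds of `Ω*` (p34 gen 16 `gBox_congr`), and the two gauges used by the tree's proofs read plaquettes only NEAR their base
points: (§1) p30's tree gauge `centredGaugeDir u x₀ R i` of the ball of sup-radius `R` is the axial gauge of the box `[x₀ − R − 2, x₀ + R + 2]`,
whose bond estimate ([Balaban1985Averaging] p. 25) uses ONLY the plaquettes of that box (`BoxPlaqSmall (pull u) lo hi δ`) — p30 fed it the
global hypothesis for convenience (`boxPlaqSmall_pull_of_le`); here it is fed the plaquettes based within `R + 2` of `x₀`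
(`boxPlaqSmall_pull_of_near`, `dist1_centredGaugeDir_le_of_near`).  (§2) p34 gen 16's blockwise change of gauge ([I] p. 326 *"by change of
gauge … in a local region"* made block by block) — the tree gauge of each `k`-block of `Ω` rooted at its corner, radius `L^k − 1` — therefore
reads only the plaquettes based within `L^k + 1 ≤ 2L^k` of a corner of a block of `Ω`, a site of `Ω`; it delivers the bondwise hypotheses of
the gen-16/18 members — `|u^h_b − 1| ≤ T` on the intra-block bonds of `Ω*`, `|u^h(Γ^{(k)}_{y_k,y}) − 1| ≤ (d+1)(L^k−1)T` for `y ∈ Ω` (the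
composite transports of `Ω` read only intra-block bonds of blocks `⊆ Ω`, `holCK_congr`) — from `‖u(∂p) − 1‖ ≤ θ` on the plaquettes based
within `2L^k` of `Ω` (`blockGauge_of_near`, `T = d(L^k−1)θ`, `d = P.d − 1`).  (§3) The gen-16/18 members at `u^h`, and back to `u` by gauge
covariance (`G_k(Ω,u^h) = M_hG_k(Ω,u)M_hᴴ`).  (§4) (2.32) ⟹ the local plaquette smallness: if `u = exp[ie_kη(A + ∂λ)]` on the four bonds of
`p` then `u(∂p) = exp(ie_kη²(∂^{η⁻¹}A)(p))` (the gradient drops out, `curl_grad`), so `‖u(∂p) − 1‖ ≤ e_kη²·|∂A(p)| ≤ e_kη²·C𝓅` from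
`|e^{iφ} − 1| ≤ |φ|`; hence every member holds under `SmoothOn e_k η C 𝓅 X B Pl u` as soon as `Pl` contains the plaquettes based within `2L^k`
of `Ω` and `B` their bonds, with thresholds on `L^{2k}·e_kη²C𝓅` (= `e_kC𝓅(e_k)` at `η = L^{−k}`: *"small"* for `e_k` small, as printed).

WHAT IS PROVED (theorems only; 0 `sorry`; standard axioms; no definition, no `Prop`-valued fact).
* §1 **`cdist_intCast_le`** (kernel), **`boxPlaqSmall_pull_of_near`** (the box hypothesis of the tree gauge from the plaquettes based within
  `R + 2` of the centre), **`dist1_centredGaugeDir_le_of_box`** / **`_of_near`** / **`_min_of_near`** / **`_supDist_of_near`** — p30's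
  `dist1_centredGaugeDir_le` / `_min` / `_supDist` VERBATIM with the global plaquette hypothesis replaced by the box / near hypothesis.
* §2 **`mem_of_blkIter_eq`**, **`cornerIter_mem`**, **`blockGauge_of_near`** — the blockwise tree gauge `h(z) = centredGaugeDir u (corner of the
  block of z) (L^k − 1) i₀` delivers, from `‖u(∂p) − 1‖ ≤ θ` on the plaquettes based within `2L^k` of `Ω` (`2(L^k−1) + 4 < |T|`,
  `T ≥ d(L^k−1)θ`): `‖u^h_b − 1‖ ≤ T` for `b ∈ Ω*` intra-block, `‖u^h(Γ^{(k)}_{y_k,y}) − 1‖ ≤ (d+1)(L^k − 1)T` for `y ∈ Ω`.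
* §3 under **plaquette smallness NEAR `Ω` ONLY** (`∀ p, (∃ y ∈ Ω, |y − p.src|_∞ ≤ 2L^k) → ‖u(∂p) − 1‖ ≤ θ`), thresholds in `(d, L^k)` as in the
  global `_uniform` members, EVERY `k`-block union `Ω`: **`decay_kernel_smoothNear_region`** (`‖G_k(Ω,u;x,y)‖ ≤ c₀(L^kε)²e^{−t₀|x−y|_∞/L^k}`, every
  dimension, every `L`, `1 ≤ k ≤ m+K`), **`decay_covD_kernel_smoothNear_region`** (`‖ε⁻¹(u_bG_k(Ω,u;b₊,y) − G_k(Ω,u;b₋,y))‖ ≤ c₁(L^kε)e^{−t₀|y−b₊|_∞/L^k}`,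
  every `b ∈ Ω*`), **`decay110_smoothNear_region`** (operator form `‖(G_k(Ω,u)f)(x)‖ ≤ (L^kε)²·c₀e^{−δ₀D/L^k}‖f‖_∞`, `P.d = d+1 ≤ 3`,
  `L = ℓ+1`, every `x`, in p31's (H1.10)-input binder shape).
* §4 **`cexp_plaq_eq`** (kernel), **`norm_plaqHol_sub_one_le_of_smoothOn`** — (2.32) ⟹ `‖u(∂p) − 1‖ ≤ e_kη²C𝓅` at every `p ∈ Pl` whose bonds lie
  in `B`; **`plaqSmall_near_of_smoothOn`** (the §3 hypothesis from `SmoothOn` near `Ω`); **`decay_kernel_smoothOn_region`**,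
  **`decay_covD_kernel_smoothOn_region`**, **`decay110_smoothOn_region`** — the three members UNDER THE PRINTED (2.32) near `Ω`.
HONEST SCOPE.  (i) The hypothesis is LOCAL as printed, in the tree's currency: plaquette smallness `‖u(∂p) − 1‖ ≤ θ` on the plaquettes BASED
within sup-distance `2L^k` of `Ω` (two `k`-blocks = `2` units of `T^{(k)}_1`; print: *"a neighborhood"*, *"an r(e_k) neighborhood"* in (2.38)
— any `O(1)`-block collar is inside print's `O(r(e_k))` collars), resp. (2.32) `SmoothOn e η C 𝓅 X B Pl (cfg u)` with `Pl ⊇` those plaquettes and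
`B ⊇` their bonds (the divergence clause `|∂*A| ≦ O(p(e_k))` of (2.32) and the site set `X` are not used by these members); thresholds
`θ ≲ 1/((d+1)²L^{2k})` exactly as in the global `_uniform` members (gen 16/18), i.e. `(L^{2k}·eη²C𝓅)`-smallness — nothing is asserted about
the size of `C𝓅(e_k)` beyond the displayed inequalities.  (ii) Members: the VALUE members (kernel, every `d`, every `L`; operator form for
`P.d ≤ 3`, `L ≥ 2`) and the covariant-derivative KERNEL member (every bond of `Ω*`); the operator-form `D_u` member at deep bonds and the (1.9)
Hölder member under the same local hypothesis are file B-II (their proofs re-run p30's interior estimates in the §1 gauges).  (iii) The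
blockwise gauge is rooted along a fixed axis `i₀` (p30's `centredGaugeDir`; its bound coincides with p344214's `centredGauge` bound) — our
device, as disclosed in p30's/p34's files; `U(1)` only where the members are (`§1` for a general `GaugeGroup`).  (iv) Torus side condition
`2(L^k − 1) + 4 < |T|` (more than two `k`-blocks per direction) as in every `_uniform` member.  DIVERGENCE OF METHOD from [6]'s random walk as
disclosed in gens 16–18.  Literature + Mathlib only.  Nothing here is summit progress, continuum or Clay.  Unit `lit-balaban-p34`
(literature-prover-lit-balaban-p34-g20-0), HOME `run/shared/lean/pub/lit-balaban/`, 2026-08-23.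
v1.1 (p34 gen 21, 2026-08-23): DOCFIX ONLY (referee ref-5 D-g73-1, pseudo-quote class): two sentences that are not on p. 263 («Recall from I
that p(e_k) = …», «Let the gauge field u be smooth near □ in the sense described above») removed from the quotation block above and replaced by
the printed sentence + a reader's note; «(2.27), and for (2.31)» → the printed «(2.27); for (2.31)».  Declarations untouched.
-/

open scoped BigOperators ComplexConjugate

namespace Literature.MathematicalPhysics.QuantumFieldTheory.BalabanImbrieJaffe1984to88.BIJ88NeumannPropagatorSmoothNearRegion

open Literature.MathematicalPhysics.QuantumFieldTheory.Balaban1983to89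
open LatticeFieldCalculus (supDist)
open B3TorusRadialSums (cdist cdist_le_supDist supDist_comm supDist_eq_sup_cdist cdist_le_val cdist_le_neg_val)
open BIJ85Ineq722Torus (supDist_triangle)
open BIJ88Sect3Statements (U1 toC cfg covD starB mem_starB norm_toC toC_one toC_mul)
open BIJ85BlockAveragesTorusK (blkIter cornerIter holCK blockK mem_blockK blkIter_cornerIter)
open BIJ88NeumannNoZeroModesTorus (IsBlockUnion)
open BIJ88NeumannPropagator227Torus (gBox)
open T4AxialGaugeSmallField (BoxPlaqSmall castSite castSite_apply castSite_add_e pull pull_apply hol_pull_plaqWord_of_lt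
  hol_pull_plaqWord_of_gt castSite_injOn_box)
open BIJ85CentredAxialGauge (dist1_axial_bond_le_general lift)
open BIJ85BiCentredAxialGauge (centredGaugeDir topIdx gaugeAct_gaugeAtFn_castSite dist1_axialFnPerm_bond_le l1_lowPart_le_offTop
  castSite_lift natAbs_valMinAbs_eq_cdist)

noncomputable section

variable {P : Params} {j : ℕ}

/-! ## §1 p30's tree gauge of a torus ball from the plaquettes NEAR the centre only -/

section LocalGauge

open B7Prop1Explicit (Letter e e_apply l1)
open B8Lemma1NonAbelian (lowPart)

variable {G : Type*} [GaugeGroup G]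

/-- kernel: the circular size of the residue of an integer is at most its absolute value — `cdist (m mod N) ≤ |m|`. [cite: Balaban1985Averaging, pp.24–25] -/
theorem cdist_intCast_le {N : ℕ} [NeZero N] {m : ℤ} {n : ℕ} (h : |m| ≤ n) : cdist ((m : ZMod N)) ≤ n := by
  rcases le_or_gt 0 m with hm | hm
  · have e1 : ((m : ℤ) : ZMod N) = ((m.toNat : ℕ) : ZMod N) := by
      rw [← Int.cast_natCast, Int.toNat_of_nonneg hm]
    rw [e1]
    refine (cdist_le_val _).trans ?_
    rw [ZMod.val_natCast]
    refine (Nat.mod_le _ _).trans ?_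
    have : (m.toNat : ℤ) ≤ n := by rw [Int.toNat_of_nonneg hm]; exact (le_abs_self m).trans h
    exact_mod_cast this
  · have hm' : 0 ≤ -m := by linarith
    have e1 : -((m : ℤ) : ZMod N) = (((-m).toNat : ℕ) : ZMod N) := by
      rw [← Int.cast_natCast, Int.toNat_of_nonneg hm', Int.cast_neg]
    refine (cdist_le_neg_val _).trans ?_
    rw [e1, ZMod.val_natCast]
    refine (Nat.mod_le _ _).trans ?_
    have : ((-m).toNat : ℤ) ≤ n := by rw [Int.toNat_of_nonneg hm']; exact (neg_le_abs m).trans h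
    exact_mod_cast this

/-- **THE BOX HYPOTHESIS OF THE TREE GAUGE FROM THE PLAQUETTES NEAR THE CENTRE**: if `dist1 (u(∂p)) ≤ δ` for every plaquette `p` BASED within
sup-distance `R + 2` of `x₀`, then the pullback of `u` is plaquette-small `≤ δ` on the box `[x₀ − R − 2, x₀ + R + 2]` of the gauge
`centredGaugeDir u x₀ R i` (both orientations by `dist1_inv`) — p30's `boxPlaqSmall_pull_of_le` with the global hypothesis replaced by the
local one. [cite: Balaban1985Averaging, pp.24–25] [cite: BalabanImbrieJaffe1988, (2.32) p.263 «in a neighborhood of each □_α»] -/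
theorem boxPlaqSmall_pull_of_near (U : GaugeField P j G) (x₀ : Balaban1983to89.Site P j) (R : ℕ) {δ : ℝ}
    (hU : ∀ p : Balaban1983to89.Plaq P j, supDist x₀ p.src ≤ R + 2 → dist1 (GaugeField.plaqHol U p) ≤ δ) :
    BoxPlaqSmall (pull U) (fun κ => lift x₀ κ - (R + 2)) (fun κ => lift x₀ κ + (R + 2)) δ := by
  intro z κ μ hκμ hlo hhi
  have hz : supDist x₀ (castSite z : Balaban1983to89.Site P j) ≤ R + 2 := by
    rw [supDist_eq_sup_cdist]
    refine Finset.sup_le fun ν _ => ?_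
    have h1 : lift x₀ ν - (R + 2) ≤ z ν := hlo ν
    have h2 : z ν + e κ ν + e μ ν ≤ lift x₀ ν + (R + 2) := hhi ν
    have h3 : 0 ≤ e κ ν := B8Lemma1NonAbelian.e_nonneg κ ν
    have h4 : 0 ≤ e μ ν := B8Lemma1NonAbelian.e_nonneg μ ν
    have hcast : x₀ ν - (castSite z : Balaban1983to89.Site P j) ν = (((lift x₀ ν - z ν : ℤ)) : ZMod (P.sitesPerDir j)) := by
      rw [castSite_apply, Int.cast_sub]
      congr 1
      rw [← castSite_apply (lift x₀) ν, castSite_lift]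
    rw [hcast]
    refine cdist_intCast_le (n := R + 2) ?_
    rw [abs_le]
    constructor
    · push_cast; linarith
    · push_cast; linarith
  rcases lt_or_gt_of_ne hκμ with h | h
  · rw [hol_pull_plaqWord_of_lt U z h]; exact hU _ hz
  · rw [hol_pull_plaqWord_of_gt U z h, GaugeGroup.dist1_inv]; exact hU _ hz

/-- **p30's `dist1_centredGaugeDir_le` FROM THE BOX HYPOTHESIS** (its proof verbatim, the global plaquette bound replaced by
`BoxPlaqSmall (pull u) [x₀ − R − 2, x₀ + R + 2] δ`): in the gauge `h = centredGaugeDir u x₀ R i` (`2R + 4 < |T|`) every bond `⟨z, z + e_μ⟩`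
with `|z − x₀|_∞ ≤ R` has `dist1 (u^h(⟨z, μ⟩)) ≤ (d − 1)·n·δ` whenever `cdist(z_ν − x₀,ν) ≤ n` for all `ν ≠ i`.
[cite: Balaban1985Averaging, pp.24–25] [cite: BalabanImbrieJaffe1985, p.326 «by change of gauge … in a local region Λ»] -/
theorem dist1_centredGaugeDir_le_of_box (U : GaugeField P j G) {δ : ℝ} (hδ : 0 ≤ δ) (x₀ : Balaban1983to89.Site P j) {R : ℕ}
    (hP : BoxPlaqSmall (pull U) (fun κ => lift x₀ κ - (R + 2)) (fun κ => lift x₀ κ + (R + 2)) δ)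
    (hR : 2 * R + 4 < P.sitesPerDir j) (i : Fin P.d) (z : Balaban1983to89.Site P j) (hz : supDist x₀ z ≤ R) (μ : Fin P.d) {n : ℕ}
    (hn : ∀ ν, ν ≠ i → cdist (z ν - x₀ ν) ≤ n) :
    dist1 (GaugeField.gaugeAct (centredGaugeDir U x₀ R i) U ⟨z, μ⟩) ≤ ((P.d - 1 : ℕ) : ℝ) * n * δ := by
  have hd : 0 < P.d := Fin.pos i
  set σ : Equiv.Perm (Fin P.d) := Equiv.swap i (topIdx hd) with hσ
  -- the integer lift of `z` by least residues of `z − x₀`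
  set s : Fin P.d → ℤ := fun κ => (z κ - x₀ κ).valMinAbs with hs
  set zi : Fin P.d → ℤ := lift x₀ + s with hzi
  have hcast : (castSite zi : Balaban1983to89.Site P j) = z := by
    funext κ
    simp only [hzi, hs, lift, castSite_apply, Pi.add_apply, Int.cast_add, Int.cast_natCast, ZMod.natCast_zmod_val,
      ZMod.coe_valMinAbs]
    abel
  have habs : ∀ κ, |s κ| ≤ ((supDist x₀ z : ℕ) : ℤ) := fun κ => by
    have h1 : (s κ).natAbs ≤ supDist x₀ z := by
      rw [hs, natAbs_valMinAbs_eq_cdist, supDist_comm]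
      exact cdist_le_supDist z x₀ κ
    rw [← Int.natCast_natAbs]; exact_mod_cast h1
  have hsz : ∀ κ, |s κ| ≤ (R : ℤ) := fun κ => (habs κ).trans (by exact_mod_cast hz)
  have hN : ∀ κ, (lift x₀ κ + (R + 2)) - (lift x₀ κ - (R + 2)) < P.sitesPerDir j := fun κ => by
    have : ((2 * R + 4 : ℕ) : ℤ) < P.sitesPerDir j := by exact_mod_cast hR
    push_cast at this
    linarith
  have hlo' : (fun κ => lift x₀ κ - (R + 2)) ≤ zi := fun κ => by
    have h1 := hsz κ; simp only [hzi, Pi.add_apply]; rw [abs_le] at h1; linarith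
  have hhi' : zi + e μ ≤ (fun κ => lift x₀ κ + (R + 2)) := fun κ => by
    have h1 := hsz κ; simp only [hzi, Pi.add_apply, e_apply]; rw [abs_le] at h1; split_ifs <;> linarith
  have hlo : ∀ κ, (lift x₀ κ - (R + 2)) + 1 ≤ min (zi κ) (lift x₀ κ) := fun κ => by
    have h1 := hsz κ
    simp only [hzi, Pi.add_apply]
    rw [abs_le] at h1
    refine le_min ?_ ?_ <;> linarith
  have hhi : ∀ κ, max (zi κ) (lift x₀ κ) + 2 ≤ lift x₀ κ + (R + 2) := fun κ => by
    have h1 := hsz κ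
    simp only [hzi, Pi.add_apply]
    rw [abs_le] at h1
    have : max (lift x₀ κ + s κ) (lift x₀ κ) ≤ lift x₀ κ + R := max_le (by linarith) (by linarith)
    linarith
  unfold centredGaugeDir
  rw [← hσ, ← hcast, gaugeAct_gaugeAtFn_castSite _ U hN hlo' hhi']
  have hmain := dist1_axialFnPerm_bond_le σ (pull U) hP (lift x₀) zi μ hlo hhi
  refine hmain.trans ?_
  have hv : (zi - lift x₀) ∘ σ = s ∘ σ := by
    have : zi - lift x₀ = s := by rw [hzi]; abel
    rw [this]
  rw [hv]
  have hl1 : l1 (lowPart (σ.symm μ) (s ∘ σ)) ≤ (P.d - 1) * n := by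
    refine l1_lowPart_le_offTop hd (σ.symm μ) fun κ hκ => ?_
    have hκi : σ κ ≠ i := by
      intro h'
      apply hκ
      have : κ = σ.symm i := by rw [← h']; simp
      rw [this, hσ, Equiv.symm_swap, Equiv.swap_apply_left]
    have h1 : (s (σ κ)).natAbs ≤ n := by
      rw [hs, natAbs_valMinAbs_eq_cdist]
      exact hn (σ κ) hκi
    simp only [Function.comp_apply]
    rw [← Int.natCast_natAbs]; exact_mod_cast h1
  have : (l1 (lowPart (σ.symm μ) (s ∘ σ)) : ℝ) ≤ ((P.d - 1 : ℕ) : ℝ) * n := by exact_mod_cast hl1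
  exact mul_le_mul_of_nonneg_right this hδ

/-- **THE BOND DEVIATIONS IN THE AXIS-ROOTED TREE GAUGE FROM THE PLAQUETTES NEAR THE CENTRE ONLY**: if `dist1 (u(∂p)) ≤ δ` for every plaquette
based within `R + 2` of `x₀` and `2R + 4 < |T|`, then in the gauge `h = centredGaugeDir u x₀ R i` every bond `⟨z, z + e_μ⟩` with `|z − x₀|_∞ ≤ R`
has `dist1 (u^h(⟨z, μ⟩)) ≤ (d − 1)·n·δ` whenever `cdist(z_ν − x₀,ν) ≤ n` for all `ν ≠ i` — p30's `dist1_centredGaugeDir_le` LOCALISED.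
[cite: Balaban1985Averaging, pp.24–25] [cite: BalabanImbrieJaffe1988, (2.32) p.263] -/
theorem dist1_centredGaugeDir_le_of_near (U : GaugeField P j G) {δ : ℝ} (hδ : 0 ≤ δ) (x₀ : Balaban1983to89.Site P j) {R : ℕ}
    (hU : ∀ p : Balaban1983to89.Plaq P j, supDist x₀ p.src ≤ R + 2 → dist1 (GaugeField.plaqHol U p) ≤ δ)
    (hR : 2 * R + 4 < P.sitesPerDir j) (i : Fin P.d) (z : Balaban1983to89.Site P j) (hz : supDist x₀ z ≤ R) (μ : Fin P.d) {n : ℕ}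
    (hn : ∀ ν, ν ≠ i → cdist (z ν - x₀ ν) ≤ n) :
    dist1 (GaugeField.gaugeAct (centredGaugeDir U x₀ R i) U ⟨z, μ⟩) ≤ ((P.d - 1 : ℕ) : ℝ) * n * δ :=
  dist1_centredGaugeDir_le_of_box U hδ x₀ (boxPlaqSmall_pull_of_near U x₀ R hU) hR i z hz μ hn

/-- The localised `dist1_centredGaugeDir_le_min`: linear growth from BOTH points of the axis through `x₀` in direction `i`.
[cite: Balaban1985Averaging, pp.24–25] [cite: BalabanImbrieJaffe1988, (2.32) p.263] -/
theorem dist1_centredGaugeDir_le_min_of_near (U : GaugeField P j G) {δ : ℝ} (hδ : 0 ≤ δ) (x₀ : Balaban1983to89.Site P j) {R : ℕ}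
    (hU : ∀ p : Balaban1983to89.Plaq P j, supDist x₀ p.src ≤ R + 2 → dist1 (GaugeField.plaqHol U p) ≤ δ)
    (hR : 2 * R + 4 < P.sitesPerDir j) (i : Fin P.d) {x₁ : Balaban1983to89.Site P j} (hx₁ : ∀ ν, ν ≠ i → x₁ ν = x₀ ν)
    (z : Balaban1983to89.Site P j) (hz : supDist x₀ z ≤ R) (μ : Fin P.d) :
    dist1 (GaugeField.gaugeAct (centredGaugeDir U x₀ R i) U ⟨z, μ⟩) ≤
      ((P.d - 1 : ℕ) : ℝ) * ((min (supDist x₀ z) (supDist x₁ z) : ℕ) : ℝ) * δ := by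
  refine dist1_centredGaugeDir_le_of_near U hδ x₀ hU hR i z hz μ fun ν hν => ?_
  refine le_min ?_ ?_
  · rw [← B3TorusRadialSums.cdist_neg, neg_sub]; exact cdist_le_supDist x₀ z ν
  · rw [← hx₁ ν hν, ← B3TorusRadialSums.cdist_neg, neg_sub]; exact cdist_le_supDist x₁ z ν

/-- The localised `dist1_centredGaugeDir_le_supDist`: `dist1 (u^h(⟨z, μ⟩)) ≤ (d−1)|z − x₀|_∞·δ`.
[cite: Balaban1985Averaging, pp.24–25] [cite: BalabanImbrieJaffe1988, (2.32) p.263] -/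
theorem dist1_centredGaugeDir_le_supDist_of_near (U : GaugeField P j G) {δ : ℝ} (hδ : 0 ≤ δ) (x₀ : Balaban1983to89.Site P j) {R : ℕ}
    (hU : ∀ p : Balaban1983to89.Plaq P j, supDist x₀ p.src ≤ R + 2 → dist1 (GaugeField.plaqHol U p) ≤ δ)
    (hR : 2 * R + 4 < P.sitesPerDir j) (i : Fin P.d) (z : Balaban1983to89.Site P j) (hz : supDist x₀ z ≤ R) (μ : Fin P.d) :
    dist1 (GaugeField.gaugeAct (centredGaugeDir U x₀ R i) U ⟨z, μ⟩) ≤ ((P.d - 1 : ℕ) : ℝ) * (supDist x₀ z : ℝ) * δ := by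
  have h := dist1_centredGaugeDir_le_min_of_near U hδ x₀ hU hR i (x₁ := x₀) (fun _ _ => rfl) z hz μ
  rwa [min_self] at h

end LocalGauge

/-! ## §2 The blockwise tree gauge of [I] p. 326 from the plaquettes NEAR `Ω` only -/

section BlockGauge

open GaugeField (gaugeAct plaqHol)
open BIJ85ScalarPropagatorDecay (supDist_le_of_blkIter_eq)
open BIJ85HolonomyDeviation (norm_holCK_sub_one_le)
open BIJ88Smooth43Axial (dist1_eq_norm_toC_sub_one)
open BIJ88NeumannPropagatorSmallPlaquetteRegion (holCK_congr)

/-- kernel: a `k`-block union contains the whole `k`-block of each of its points. [cite: BalabanImbrieJaffe1988, (2.27) p.263] -/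
theorem mem_of_blkIter_eq {k : ℕ} {Ω : Finset (Balaban1983to89.Site P j)} (hΩ : IsBlockUnion k Ω) {y z : Balaban1983to89.Site P j}
    (hy : y ∈ Ω) (h : blkIter k z = blkIter k y) : z ∈ Ω :=
  hΩ y hy (mem_blockK.2 h)

/-- kernel: the corner of the block of a point of a `k`-block union lies in the union. [cite: BalabanImbrieJaffe1988, (2.27) p.263] -/
theorem cornerIter_mem {k : ℕ} (hk : j + k ≤ P.m + P.K) {Ω : Finset (Balaban1983to89.Site P j)} (hΩ : IsBlockUnion k Ω)
    {y : Balaban1983to89.Site P j} (hy : y ∈ Ω) : cornerIter k (blkIter k y) ∈ Ω :=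
  mem_of_blkIter_eq hΩ hy (blkIter_cornerIter k hk _)

/-- **THE BLOCKWISE CHANGE OF GAUGE OF [I] p. 326 FROM THE PLAQUETTES NEAR `Ω` ONLY** (p34 gen 16's `smallField_blockGauge` LOCALISED): in the
gauge `h(z) =` the tree gauge of the `k`-block of `z` rooted at its corner (radius `L^k − 1`, axis `i₀`), if `‖u(∂p) − 1‖ ≤ θ` for every
plaquette `p` BASED within sup-distance `2L^k` of `Ω` and `2(L^k − 1) + 4 < |T|`, then for every `T ≥ d(L^k − 1)θ` (`d = P.d − 1`):
`‖u^h_b − 1‖ ≤ T` for every intra-block bond `b ∈ Ω*`, and `‖u^h(Γ^{(k)}_{y_k,y}) − 1‖ ≤ (d+1)(L^k − 1)T` for every `y ∈ Ω` — exactly the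
bondwise hypotheses INSIDE `Ω` of the gen-16/18 region members.  The block gauges of the blocks of `Ω` read only plaquettes based within
`L^k + 1` of a corner of a block of `Ω` (§1), and the composite transports of `Ω` read only intra-block bonds of blocks `⊆ Ω` (`holCK_congr`).
[cite: BalabanImbrieJaffe1985, p.326 «by change of gauge u_k can be transformed in a local region Λ»] [cite: BalabanImbrieJaffe1988, (2.32) p.263] -/
theorem blockGauge_of_near {k : ℕ} (hk : j + k ≤ P.m + P.K) (U : GaugeField P j U1) {θ : ℝ} (hθ : 0 ≤ θ)
    {Ω : Finset (Balaban1983to89.Site P j)} (hΩ : IsBlockUnion k Ω)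
    (hplaq : ∀ p : Balaban1983to89.Plaq P j, (∃ y ∈ Ω, supDist y p.src ≤ 2 * P.L ^ k) → ‖toC (plaqHol U p) - 1‖ ≤ θ)
    (hR : 2 * (P.L ^ k - 1) + 4 < P.sitesPerDir j) {T : ℝ} (hT : ((P.d - 1 : ℕ) : ℝ) * ((P.L : ℝ) ^ k - 1) * θ ≤ T) (i₀ : Fin P.d) :
    (∀ b ∈ starB Ω, blkIter k b.src = blkIter k b.tgt →
        ‖toC (gaugeAct (fun z => centredGaugeDir U (cornerIter k (blkIter k z)) (P.L ^ k - 1) i₀ z) U b) - 1‖ ≤ T) ∧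
      ∀ y ∈ Ω, ‖holCK (gaugeAct (fun z => centredGaugeDir U (cornerIter k (blkIter k z)) (P.L ^ k - 1) i₀ z) U) k y - 1‖
          ≤ P.d * ((P.L : ℝ) ^ k - 1) * T := by
  set R : ℕ := P.L ^ k - 1 with hRdef
  set h : GaugeTransf P j U1 := fun z => centredGaugeDir U (cornerIter k (blkIter k z)) R i₀ z with hh
  have hL1 : (1 : ℝ) < P.L := B1RG242Torus.one_lt_cast_L P
  have hLk : 1 ≤ P.L ^ k := Nat.one_le_pow _ _ P.L_pos
  have hcast : ((R : ℕ) : ℝ) = (P.L : ℝ) ^ k - 1 := by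
    rw [hRdef, Nat.cast_sub hLk, Nat.cast_pow, Nat.cast_one]
  have hT0 : 0 ≤ T := by
    refine le_trans (mul_nonneg (mul_nonneg (Nat.cast_nonneg _) ?_) hθ) hT
    have : (1 : ℝ) ≤ (P.L : ℝ) ^ k := one_le_pow₀ hL1.le
    linarith
  -- the plaquettes of the box of the block gauge rooted at a corner `x₀ ∈ Ω` are near `Ω`
  have hnear : ∀ x₀ ∈ Ω, ∀ p : Balaban1983to89.Plaq P j, supDist x₀ p.src ≤ R + 2 → dist1 (plaqHol U p) ≤ θ := by
    intro x₀ hx₀ p hp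
    rw [dist1_eq_norm_toC_sub_one]
    refine hplaq p ⟨x₀, hx₀, hp.trans ?_⟩
    rw [hRdef]; omega
  -- every intra-block bond of `Ω*` is `T`-small for `u^h`: it is a bond of the block's own tree-gauged field
  have hbond : ∀ b ∈ starB Ω, blkIter k b.src = blkIter k b.tgt → ‖toC (gaugeAct h U b) - 1‖ ≤ T := by
    intro b hbΩ hb
    set x₀ : Balaban1983to89.Site P j := cornerIter k (blkIter k b.src) with hx₀
    have hsrc : b.src ∈ Ω := ((mem_starB Ω b).1 hbΩ).1
    have hx₀Ω : x₀ ∈ Ω := cornerIter_mem hk hΩ hsrc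
    have e : gaugeAct h U b = gaugeAct (centredGaugeDir U x₀ R i₀) U ⟨b.src, b.dir⟩ := by
      show h b.src * U b * (h b.tgt)⁻¹ = centredGaugeDir U x₀ R i₀ b.src * U b * (centredGaugeDir U x₀ R i₀ b.tgt)⁻¹
      simp only [hh, hx₀, hb]
    have hz : supDist x₀ b.src ≤ R :=
      supDist_le_of_blkIter_eq hk (by rw [hx₀, blkIter_cornerIter k hk])
    have h2 := dist1_centredGaugeDir_le_supDist_of_near U hθ x₀ (hnear x₀ hx₀Ω) hR i₀ b.src hz b.dir
    rw [dist1_eq_norm_toC_sub_one] at h2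
    rw [e]
    refine h2.trans (le_trans ?_ hT)
    have hz' : (supDist x₀ b.src : ℝ) ≤ (P.L : ℝ) ^ k - 1 := by rw [← hcast]; exact_mod_cast hz
    exact mul_le_mul_of_nonneg_right (mul_le_mul_of_nonneg_left hz' (Nat.cast_nonneg _)) hθ
  refine ⟨hbond, fun y hy => ?_⟩
  -- the composite transports of `u^h` at `y ∈ Ω` read only intra-block bonds of the block of `y` (`⊆ Ω`): cut the field to them
  set V : GaugeField P j U1 := fun b => if blkIter k b.src = blkIter k b.tgt ∧ b.src ∈ Ω then gaugeAct h U b else 1 with hV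
  have hVb : ∀ b : PBond P j, ‖toC (V b) - 1‖ ≤ T := fun b => by
    by_cases hb : blkIter k b.src = blkIter k b.tgt ∧ b.src ∈ Ω
    · have h1 : V b = gaugeAct h U b := by simp only [hV]; exact if_pos hb
      have htgt : b.tgt ∈ Ω := mem_of_blkIter_eq hΩ hb.2 hb.1.symm
      rw [h1]; exact hbond b ((mem_starB Ω b).2 ⟨hb.2, htgt⟩) hb.1
    · have h1 : V b = 1 := by simp only [hV]; exact if_neg hb
      rw [h1, toC_one, sub_self, norm_zero]; exact hT0
  have hcongr : holCK (gaugeAct h U) k y = holCK V k y :=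
    holCK_congr k hk y fun b hb1 hb2 => by
      have hsrc : b.src ∈ Ω := mem_of_blkIter_eq hΩ hy hb1
      have h1 : V b = gaugeAct h U b := by simp only [hV]; exact if_pos ⟨hb1.trans hb2.symm, hsrc⟩
      rw [h1]
  rw [hcongr]
  exact norm_holCK_sub_one_le hT0 hVb k y

end BlockGauge

/-! ## §3 The [6] (1.10)-type members of `G_k(Ω,u)` under plaquette smallness NEAR `Ω` only, every `k`-block union -/

section Members

open Matrix
open GaugeField (gaugeAct plaqHol)
open BIJ88NeumannPropagatorSmallFieldRegion (decay_kernel_smallField_region decay_covD_kernel_smallField_region)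
open BIJ88NeumannPropagatorSmallPlaquetteRegion (norm_covD_gBox_gaugeAct)
open BIJ88NeumannPropagatorSmallFieldRegionSup (decay110_smallField_region_input)
open BIJ88DeltaLoc234Torus (mulOp gBox_gaugeAct gBox_gaugeAct_apply conjTranspose_mul_mulOp)

/-- **[6] (1.10), KERNEL VALUE MEMBER, UNDER PLAQUETTE SMALLNESS NEAR `Ω` ONLY, EVERY `k`-BLOCK UNION** (p34 gen 16's
`decay_kernel_smallPlaquette_region_uniform` with the global hypothesis replaced by the printed local one): there are `t₀, c₀ > 0` depending on
`(d, a)` only such that for every volume with `P.d = d` and `2(L^k − 1) + 4 < |T|`, every `1 ≤ k ≤ m + K`, EVERY union `Ω` of `k`-blocks,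
every `U(1)` field with `‖u(∂p) − 1‖ ≤ θ` for the plaquettes based within `2L^k` of `Ω` (nothing assumed elsewhere), every `T ≥ (d−1)(L^k−1)θ`
with `2(L^k−1)L^k·d·T² + 2(d(L^k−1)T)² ≤ 1/2`, all `x, y`: `‖G_k(Ω,u;x,y)‖ ≤ c₀(L^kε)²e^{−t₀|x−y|_∞/L^k}`.
[cite: BalabanImbrieJaffe1988, (2.30)–(2.32) p.263] [cite: Balaban1983RegularityDecay, Theorem p.573 (1.10)] [cite: BalabanImbrieJaffe1985, (7.3.2) p.326] -/
theorem decay_kernel_smoothNear_region (d : ℕ) {a : ℝ} (ha : 0 < a) :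
    ∃ t₀ c₀ : ℝ, 0 < t₀ ∧ 0 < c₀ ∧ ∀ (P : Params), P.d = d →
      ∀ k : ℕ, 1 ≤ k → k ≤ P.m + P.K → 2 * (P.L ^ k - 1) + 4 < P.sitesPerDir 0 →
      ∀ (Ω : Finset (Balaban1983to89.Site P 0)), IsBlockUnion k Ω →
      ∀ (U : GaugeField P 0 U1) (θ : ℝ), 0 ≤ θ →
        (∀ p : Balaban1983to89.Plaq P 0, (∃ y ∈ Ω, supDist y p.src ≤ 2 * P.L ^ k) → ‖toC (plaqHol U p) - 1‖ ≤ θ) →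
        ∀ (T : ℝ), ((P.d - 1 : ℕ) : ℝ) * ((P.L : ℝ) ^ k - 1) * θ ≤ T →
          2 * (((P.L : ℝ) ^ k - 1) * (P.L : ℝ) ^ k) * P.d * T ^ 2 + 2 * (P.d * ((P.L : ℝ) ^ k - 1) * T) ^ 2 ≤ 1 / 2 →
          ∀ x y : Balaban1983to89.Site P 0,
            ‖gBox (B1RG242Torus.α P a k * (P.L : ℝ) ^ (k * P.d)) P.eps⁻¹ U k Ω x y‖ ≤
              c₀ * P.spacing k ^ 2 * Real.exp (-(t₀ * (supDist x y : ℝ) / (P.L : ℝ) ^ k)) := by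
  obtain ⟨t₀, c₀, ht₀, hc₀, H⟩ := decay_kernel_smallField_region d ha
  refine ⟨t₀, c₀, ht₀, hc₀, ?_⟩
  intro P hPd k hk1 hk hR Ω hΩ U θ hθ hplaq T hT hsmall x y
  have hk0 : 0 + k ≤ P.m + P.K := by omega
  have hL1 : (1 : ℝ) < P.L := B1RG242Torus.one_lt_cast_L P
  have hα : 0 < B1RG242Torus.α P a k := mul_pos (B1.aSeq_pos ha hL1 hk1) (inv_pos.2 (pow_pos (P.spacing_pos k) 2))
  have ha' : 0 < B1RG242Torus.α P a k * (P.L : ℝ) ^ (k * P.d) := mul_pos hα (pow_pos P.cast_L_pos _)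
  have hc : P.eps⁻¹ ≠ 0 := inv_ne_zero P.eps_pos.ne'
  set i₀ : Fin P.d := ⟨0, lt_of_lt_of_le Nat.zero_lt_one P.hd⟩ with hi₀
  obtain ⟨hbond, htree⟩ := blockGauge_of_near hk0 U hθ hΩ hplaq hR hT i₀
  set h : GaugeTransf P 0 U1 := fun z => centredGaugeDir U (cornerIter k (blkIter k z)) (P.L ^ k - 1) i₀ z with hh
  have hdec := H P hPd k hk1 hk Ω hΩ (gaugeAct h U) T (P.d * ((P.L : ℝ) ^ k - 1) * T) hbond htree hsmall x y
  rw [gBox_gaugeAct_apply hk0 hc ha' h U hΩ x y, norm_mul, norm_mul, norm_toC, one_mul, RCLike.norm_conj, norm_toC, mul_one] at hdec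
  exact hdec

/-- **[6] (1.10), COVARIANT-DERIVATIVE KERNEL MEMBER, UNDER PLAQUETTE SMALLNESS NEAR `Ω` ONLY, EVERY `k`-BLOCK UNION**, same data, every bond
`b ∈ Ω*`, every `y`: `‖ε⁻¹(u_bG_k(Ω,u;b₊,y) − G_k(Ω,u;b₋,y))‖ ≤ c₁(L^kε)e^{−t₀|y−b₊|_∞/L^k}` (p34 gen 16's
`decay_covD_kernel_smallPlaquette_region_uniform` localised; the modulus of the covariant derivative of the kernel is gauge invariant).
[cite: BalabanImbrieJaffe1988, (2.30)–(2.32) p.263, Claim p.263 «covariant derivatives»] [cite: Balaban1983RegularityDecay, Theorem p.573 (1.10)] -/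
theorem decay_covD_kernel_smoothNear_region (d : ℕ) {a : ℝ} (ha : 0 < a) :
    ∃ t₀ c₁ : ℝ, 0 < t₀ ∧ 0 < c₁ ∧ ∀ (P : Params), P.d = d →
      ∀ k : ℕ, 1 ≤ k → k ≤ P.m + P.K → 2 * (P.L ^ k - 1) + 4 < P.sitesPerDir 0 →
      ∀ (Ω : Finset (Balaban1983to89.Site P 0)), IsBlockUnion k Ω →
      ∀ (U : GaugeField P 0 U1) (θ : ℝ), 0 ≤ θ →
        (∀ p : Balaban1983to89.Plaq P 0, (∃ y ∈ Ω, supDist y p.src ≤ 2 * P.L ^ k) → ‖toC (plaqHol U p) - 1‖ ≤ θ) →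
        ∀ (T : ℝ), ((P.d - 1 : ℕ) : ℝ) * ((P.L : ℝ) ^ k - 1) * θ ≤ T →
          2 * (((P.L : ℝ) ^ k - 1) * (P.L : ℝ) ^ k) * P.d * T ^ 2 + 2 * (P.d * ((P.L : ℝ) ^ k - 1) * T) ^ 2 ≤ 1 / 2 →
          ∀ b ∈ starB Ω, ∀ y : Balaban1983to89.Site P 0,
            ‖covD P.eps⁻¹ (cfg U) (fun x => gBox (B1RG242Torus.α P a k * (P.L : ℝ) ^ (k * P.d)) P.eps⁻¹ U k Ω x y) b‖ ≤
              c₁ * P.spacing k * Real.exp (-(t₀ * (supDist y b.tgt : ℝ) / (P.L : ℝ) ^ k)) := by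
  obtain ⟨t₀, c₁, ht₀, hc₁, H⟩ := decay_covD_kernel_smallField_region d ha
  refine ⟨t₀, c₁, ht₀, hc₁, ?_⟩
  intro P hPd k hk1 hk hR Ω hΩ U θ hθ hplaq T hT hsmall b hb y
  have hk0 : 0 + k ≤ P.m + P.K := by omega
  have hL1 : (1 : ℝ) < P.L := B1RG242Torus.one_lt_cast_L P
  have hα : 0 < B1RG242Torus.α P a k := mul_pos (B1.aSeq_pos ha hL1 hk1) (inv_pos.2 (pow_pos (P.spacing_pos k) 2))
  have ha' : 0 < B1RG242Torus.α P a k * (P.L : ℝ) ^ (k * P.d) := mul_pos hα (pow_pos P.cast_L_pos _)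
  have hc : P.eps⁻¹ ≠ 0 := inv_ne_zero P.eps_pos.ne'
  set i₀ : Fin P.d := ⟨0, lt_of_lt_of_le Nat.zero_lt_one P.hd⟩ with hi₀
  obtain ⟨hbond, htree⟩ := blockGauge_of_near hk0 U hθ hΩ hplaq hR hT i₀
  set h : GaugeTransf P 0 U1 := fun z => centredGaugeDir U (cornerIter k (blkIter k z)) (P.L ^ k - 1) i₀ z with hh
  have hdec := H P hPd k hk1 hk Ω hΩ (gaugeAct h U) T (P.d * ((P.L : ℝ) ^ k - 1) * T) hbond htree hsmall b hb y
  rw [norm_covD_gBox_gaugeAct hk0 hc ha' h U hΩ b y] at hdec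
  exact hdec

/-- **[6] (1.10), OPERATOR-FORM VALUE MEMBER, `k`-UNIFORM, UNDER PLAQUETTE SMALLNESS NEAR `Ω` ONLY, EVERY `k`-BLOCK UNION** (p34 gen 18's
`decay110_smallPlaquette_region_uniform` localised, in p31's (H1.10)-input binder shape): there are `δ₀, c₀ > 0` depending on `(d, ℓ, a)` only
such that for every volume with `P.d = d + 1 ≤ 3`, `P.L = ℓ + 1` and `2(L^k − 1) + 4 < |T|`, every `1 ≤ k ≤ m + K`, EVERY `k`-block union `Ω`,
every `U(1)` field with `‖u(∂p) − 1‖ ≤ θ` for the plaquettes based within `2L^k` of `Ω`, every `T ≥ d(L^k − 1)θ` with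
`2(L^k−1)L^k(d+1)T² + 2((d+1)(L^k−1)T)² ≤ 1/2`, every `x` and every `f` with `‖f‖_∞ ≤ F` vanishing on `{T(x,·) < D}`:
`‖(G_k(Ω,u)f)(x)‖ ≤ (L^kε)²·c₀e^{−δ₀D/L^k}F`.  Proof: §2 at `u^h`, gen 18's `decay110_smallField_region_input`, and
`G_k(Ω,u) = M_hᴴG_k(Ω,u^h)M_h` (p31 `gBox_gaugeAct`).
[cite: BalabanImbrieJaffe1988, (2.30)–(2.32) p.263] [cite: Balaban1983RegularityDecay, Theorem p.573 (1.10)] [cite: BalabanImbrieJaffe1985, (7.3.2) p.326] -/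
theorem decay110_smoothNear_region (d ℓ : ℕ) (hd3 : d + 1 ≤ 3) (hℓ : 1 ≤ ℓ) {a : ℝ} (ha : 0 < a) :
    ∃ δ₀ c₀ : ℝ, 0 < δ₀ ∧ 0 < c₀ ∧ ∀ (P : Params), P.d = d + 1 → P.L = ℓ + 1 →
      ∀ k : ℕ, 1 ≤ k → k ≤ P.m + P.K → 2 * (P.L ^ k - 1) + 4 < P.sitesPerDir 0 →
      ∀ (Ω : Finset (Balaban1983to89.Site P 0)), IsBlockUnion k Ω →
      ∀ (U : GaugeField P 0 U1) (θ : ℝ), 0 ≤ θ →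
        (∀ p : Balaban1983to89.Plaq P 0, (∃ y ∈ Ω, supDist y p.src ≤ 2 * P.L ^ k) → ‖toC (plaqHol U p) - 1‖ ≤ θ) →
        ∀ (T : ℝ), ((P.d - 1 : ℕ) : ℝ) * ((P.L : ℝ) ^ k - 1) * θ ≤ T →
          2 * (((P.L : ℝ) ^ k - 1) * (P.L : ℝ) ^ k) * P.d * T ^ 2 + 2 * (P.d * ((P.L : ℝ) ^ k - 1) * T) ^ 2 ≤ 1 / 2 →
          ∀ (x : Balaban1983to89.Site P 0) (f : Balaban1983to89.Site P 0 → ℂ) (F D : ℝ), (∀ y, ‖f y‖ ≤ F) →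
            (∀ y, f y ≠ 0 → D ≤ B5Ineq137Torus.T P 0 x y) →
            ‖(gBox (B1RG242Torus.α P a k * (P.L : ℝ) ^ (k * P.d)) P.eps⁻¹ U k Ω *ᵥ f) x‖
              ≤ P.spacing k ^ 2 * (c₀ * Real.exp (-(δ₀ * (((P.L : ℝ) ^ k)⁻¹ * D))) * F) := by
  obtain ⟨δ₀, c₀, hδ₀, hc₀, H⟩ := decay110_smallField_region_input d ℓ hd3 hℓ ha
  refine ⟨δ₀, c₀, hδ₀, hc₀, ?_⟩
  intro P hPd hPL k hk1 hk hR Ω hΩ U θ hθ hplaq T hT hsmall x f F D hF hsupp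
  have hk0 : 0 + k ≤ P.m + P.K := by omega
  have hL1 : (1 : ℝ) < P.L := B1RG242Torus.one_lt_cast_L P
  have ha' : 0 < B1RG242Torus.α P a k * (P.L : ℝ) ^ (k * P.d) :=
    mul_pos (mul_pos (B1.aSeq_pos ha hL1 hk1) (inv_pos.2 (pow_pos (P.spacing_pos k) 2))) (pow_pos P.cast_L_pos _)
  have hc' : P.eps⁻¹ ≠ 0 := inv_ne_zero P.eps_pos.ne'
  set i₀ : Fin P.d := ⟨0, lt_of_lt_of_le Nat.zero_lt_one P.hd⟩ with hi₀
  obtain ⟨hbond, htree⟩ := blockGauge_of_near hk0 U hθ hΩ hplaq hR hT i₀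
  set h : GaugeTransf P 0 U1 := fun z => centredGaugeDir U (cornerIter k (blkIter k z)) (P.L ^ k - 1) i₀ z with hh
  -- `G_k(Ω,u) = M_hᴴ·G_k(Ω,u^h)·M_h`
  have hGU : gBox (B1RG242Torus.α P a k * (P.L : ℝ) ^ (k * P.d)) P.eps⁻¹ U k Ω =
      (mulOp h)ᴴ * gBox (B1RG242Torus.α P a k * (P.L : ℝ) ^ (k * P.d)) P.eps⁻¹ (gaugeAct h U) k Ω * mulOp h := by
    rw [gBox_gaugeAct hk0 hc' ha' h U hΩ, Matrix.mul_assoc, Matrix.mul_assoc, Matrix.mul_assoc, conjTranspose_mul_mulOp,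
      Matrix.mul_one, ← Matrix.mul_assoc, conjTranspose_mul_mulOp, Matrix.one_mul]
  have hmo : ∀ (w : Balaban1983to89.Site P 0 → ℂ) (z : Balaban1983to89.Site P 0), (mulOp h *ᵥ w) z = toC (h z) * w z :=
    fun w z => by simp only [mulOp, mulVec_diagonal]
  have hmoH : ∀ (w : Balaban1983to89.Site P 0 → ℂ) (z : Balaban1983to89.Site P 0), ((mulOp h)ᴴ *ᵥ w) z = star (toC (h z)) * w z :=
    fun w z => by simp only [mulOp, diagonal_conjTranspose, mulVec_diagonal, Pi.star_apply]
  rw [hGU, ← mulVec_mulVec, ← mulVec_mulVec, hmoH, norm_mul, norm_star, norm_toC, one_mul]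
  refine H P hPd hPL k hk1 hk Ω hΩ (gaugeAct h U) T (P.d * ((P.L : ℝ) ^ k - 1) * T) hbond htree hsmall x _ F D (fun y => ?_)
    (fun y hy => hsupp y ?_)
  · rw [hmo, norm_mul, norm_toC, one_mul]; exact hF y
  · intro hf
    exact hy (by rw [hmo, hf, mul_zero])

end Members

/-! ## §4 The printed smoothness (2.32) `u = exp[ie_kη(A + ∂λ)]`, `|∂A| ≦ C·𝓅`, near `Ω` ⟹ the local plaquette smallness ⟹ the members -/

section Smooth

open Matrix
open GaugeField (plaqHol)
open BIJ88Sect2Statements (SmoothOn)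
open BIJ85BlockAveragesTorus (toC_inv')

/-- kernel: the product of four phases around a plaquette. [cite: BalabanImbrieJaffe1985, (2.5) p.302] -/
private theorem cexp_plaq_eq (r₁ r₂ r₃ r₄ : ℝ) :
    Complex.exp (Complex.I * (r₁ : ℂ)) * Complex.exp (Complex.I * (r₂ : ℂ)) * (Complex.exp (Complex.I * (r₃ : ℂ)))⁻¹ *
        (Complex.exp (Complex.I * (r₄ : ℂ)))⁻¹ = Complex.exp (Complex.I * ((r₁ + r₂ - r₃ - r₄ : ℝ) : ℂ)) := by
  rw [← Complex.exp_neg, ← Complex.exp_neg, ← Complex.exp_add, ← Complex.exp_add, ← Complex.exp_add]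
  congr 1
  push_cast
  ring

/-- **(2.32) ⟹ PLAQUETTE SMALLNESS**: if `u = exp[ie_kη(A + ∂λ)]` on the four bonds of the plaquette `p ∈ Pl` and `|(∂^{η⁻¹}A)(p)| ≤ C·𝓅`
(r18's `SmoothOn e_k η C 𝓅 X B Pl (cfg u)`, the printed (2.32) with its `O(·)` constant explicit), then `u(∂p) = exp(ie_kη²(∂A)(p))` — the
gradient drops out of the plaquette (`curl_grad`) — and `‖u(∂p) − 1‖ ≤ e_kη²·C·𝓅` (`|e^{iφ} − 1| ≤ |φ|`).
[cite: BalabanImbrieJaffe1988, (2.32) p.263] [cite: BalabanImbrieJaffe1985, (2.5) p.302] -/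
theorem norm_plaqHol_sub_one_le_of_smoothOn {ek η C pek : ℝ} (hek : 0 ≤ ek) {X : Finset (Balaban1983to89.Site P j)}
    {B : Finset (PBond P j)} {Pl : Finset (Balaban1983to89.Plaq P j)} {U : GaugeField P j U1}
    (hS : SmoothOn ek η C pek X B Pl (cfg U)) (p : Balaban1983to89.Plaq P j) (hp : p ∈ Pl)
    (hb₁ : (⟨p.src, p.μ⟩ : PBond P j) ∈ B) (hb₂ : (⟨p.src.shift p.μ, p.ν⟩ : PBond P j) ∈ B)
    (hb₃ : (⟨p.src.shift p.ν, p.μ⟩ : PBond P j) ∈ B) (hb₄ : (⟨p.src, p.ν⟩ : PBond P j) ∈ B) :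
    ‖toC (plaqHol U p) - 1‖ ≤ ek * η ^ 2 * (C * pek) := by
  obtain ⟨A, lam, hrep, hcurl, -⟩ := hS
  set g : PBond P j → ℝ := LatticeFieldCalculus.grad η⁻¹ lam with hg
  have e : toC (plaqHol U p) = cfg U ⟨p.src, p.μ⟩ * cfg U ⟨p.src.shift p.μ, p.ν⟩ * (cfg U ⟨p.src.shift p.ν, p.μ⟩)⁻¹ *
      (cfg U ⟨p.src, p.ν⟩)⁻¹ := by
    simp only [plaqHol, cfg, toC_mul, toC_inv']
  rw [e, hrep _ hb₁, hrep _ hb₂, hrep _ hb₃, hrep _ hb₄, cexp_plaq_eq]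
  -- the exponent is `e η² (∂A)(p)`: the gradient drops out
  have hsum : ek * η * (A ⟨p.src, p.μ⟩ + g ⟨p.src, p.μ⟩) + ek * η * (A ⟨p.src.shift p.μ, p.ν⟩ + g ⟨p.src.shift p.μ, p.ν⟩) -
      ek * η * (A ⟨p.src.shift p.ν, p.μ⟩ + g ⟨p.src.shift p.ν, p.μ⟩) - ek * η * (A ⟨p.src, p.ν⟩ + g ⟨p.src, p.ν⟩) =
      ek * η ^ 2 * LatticeFieldCalculus.curl η⁻¹ A p := by
    rcases eq_or_ne η 0 with h0 | h0
    · simp [h0]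
    · have hcg : LatticeFieldCalculus.curl η⁻¹ g p = 0 := by rw [hg]; exact LatticeFieldCalculus.curl_grad _ _ _ _
      have hgsum : g ⟨p.src, p.μ⟩ + g ⟨p.src.shift p.μ, p.ν⟩ - g ⟨p.src.shift p.ν, p.μ⟩ - g ⟨p.src, p.ν⟩ = 0 := by
        simp only [LatticeFieldCalculus.curl, smul_eq_mul] at hcg
        rcases mul_eq_zero.1 hcg with h1 | h1
        · exact absurd (inv_eq_zero.1 h1) h0
        · exact h1
      have hcA : LatticeFieldCalculus.curl η⁻¹ A p =
          η⁻¹ * (A ⟨p.src, p.μ⟩ + A ⟨p.src.shift p.μ, p.ν⟩ - A ⟨p.src.shift p.ν, p.μ⟩ - A ⟨p.src, p.ν⟩) := by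
        simp only [LatticeFieldCalculus.curl, smul_eq_mul]
      rw [hcA]
      have hη2 : η ^ 2 * η⁻¹ = η := by field_simp
      linear_combination (ek * η) * hgsum -
        (ek * (A ⟨p.src, p.μ⟩ + A ⟨p.src.shift p.μ, p.ν⟩ - A ⟨p.src.shift p.ν, p.μ⟩ - A ⟨p.src, p.ν⟩)) * hη2
  rw [hsum]
  have h1 := Real.norm_exp_I_mul_ofReal_sub_one_le (x := ek * η ^ 2 * LatticeFieldCalculus.curl η⁻¹ A p)
  refine h1.trans ?_
  rw [Real.norm_eq_abs, abs_mul, abs_mul, abs_of_nonneg hek, abs_of_nonneg (sq_nonneg η)]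
  exact mul_le_mul_of_nonneg_left (hcurl p hp) (by positivity)

/-- **(2.32) NEAR `Ω` ⟹ THE LOCAL PLAQUETTE HYPOTHESIS OF §§2–3**: if `SmoothOn e_k η C 𝓅 X B Pl (cfg u)` with `Pl` containing every
plaquette based within `2L^k` of `Ω` and `B` the four bonds of each plaquette of `Pl` (*"smoothness throughout the subset Ω"*, *"in a
neighborhood of each □_α"*), then `‖u(∂p) − 1‖ ≤ e_kη²C𝓅` for every plaquette based within `2L^k` of `Ω`.
[cite: BalabanImbrieJaffe1988, (2.32) p.263] -/
theorem plaqSmall_near_of_smoothOn {ek η C pek : ℝ} (hek : 0 ≤ ek) {X : Finset (Balaban1983to89.Site P j)}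
    {B : Finset (PBond P j)} {Pl : Finset (Balaban1983to89.Plaq P j)} {U : GaugeField P j U1}
    (hS : SmoothOn ek η C pek X B Pl (cfg U)) {k : ℕ} {Ω : Finset (Balaban1983to89.Site P j)}
    (hPl : ∀ p : Balaban1983to89.Plaq P j, (∃ y ∈ Ω, supDist y p.src ≤ 2 * P.L ^ k) → p ∈ Pl)
    (hB : ∀ p ∈ Pl, (⟨p.src, p.μ⟩ : PBond P j) ∈ B ∧ (⟨p.src.shift p.μ, p.ν⟩ : PBond P j) ∈ B ∧
      (⟨p.src.shift p.ν, p.μ⟩ : PBond P j) ∈ B ∧ (⟨p.src, p.ν⟩ : PBond P j) ∈ B) :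
    ∀ p : Balaban1983to89.Plaq P j, (∃ y ∈ Ω, supDist y p.src ≤ 2 * P.L ^ k) → ‖toC (plaqHol U p) - 1‖ ≤ ek * η ^ 2 * (C * pek) := by
  intro p hp
  have hpPl := hPl p hp
  obtain ⟨h1, h2, h3, h4⟩ := hB p hpPl
  exact norm_plaqHol_sub_one_le_of_smoothOn hek hS p hpPl h1 h2 h3 h4

/-- **[6] (1.10) KERNEL VALUE MEMBER UNDER THE PRINTED (2.32) NEAR `Ω`** — `decay_kernel_smoothNear_region` at `θ = e_kη²C𝓅`: for every volume
(`P.d = d`, `2(L^k−1)+4 < |T|`), every `1 ≤ k ≤ m+K`, every `k`-block union `Ω`, every `U(1)` field `u` with `SmoothOn e_k η C 𝓅 X B Pl (cfg u)`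
near `Ω` (`Pl ⊇` the plaquettes based within `2L^k` of `Ω`, `B ⊇` their bonds; `0 ≤ e_k`, `0 ≤ C𝓅`), every `T ≥ (d−1)(L^k−1)·e_kη²C𝓅` with
`2(L^k−1)L^k·d·T² + 2(d(L^k−1)T)² ≤ 1/2`: `‖G_k(Ω,u;x,y)‖ ≤ c₀(L^kε)²e^{−t₀|x−y|_∞/L^k}` — (2.30)-type decay of the region propagators under
their PRINTED hypothesis. [cite: BalabanImbrieJaffe1988, (2.30)–(2.32) p.263] [cite: Balaban1983RegularityDecay, Theorem p.573 (1.10)] -/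
theorem decay_kernel_smoothOn_region (d : ℕ) {a : ℝ} (ha : 0 < a) :
    ∃ t₀ c₀ : ℝ, 0 < t₀ ∧ 0 < c₀ ∧ ∀ (P : Params), P.d = d →
      ∀ k : ℕ, 1 ≤ k → k ≤ P.m + P.K → 2 * (P.L ^ k - 1) + 4 < P.sitesPerDir 0 →
      ∀ (Ω : Finset (Balaban1983to89.Site P 0)), IsBlockUnion k Ω →
      ∀ (U : GaugeField P 0 U1) (ek η C pek : ℝ), 0 ≤ ek → 0 ≤ C * pek →
      ∀ (X : Finset (Balaban1983to89.Site P 0)) (B : Finset (PBond P 0)) (Pl : Finset (Balaban1983to89.Plaq P 0)),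
        SmoothOn ek η C pek X B Pl (cfg U) →
        (∀ p : Balaban1983to89.Plaq P 0, (∃ y ∈ Ω, supDist y p.src ≤ 2 * P.L ^ k) → p ∈ Pl) →
        (∀ p ∈ Pl, (⟨p.src, p.μ⟩ : PBond P 0) ∈ B ∧ (⟨p.src.shift p.μ, p.ν⟩ : PBond P 0) ∈ B ∧
          (⟨p.src.shift p.ν, p.μ⟩ : PBond P 0) ∈ B ∧ (⟨p.src, p.ν⟩ : PBond P 0) ∈ B) →
        ∀ (T : ℝ), ((P.d - 1 : ℕ) : ℝ) * ((P.L : ℝ) ^ k - 1) * (ek * η ^ 2 * (C * pek)) ≤ T →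
          2 * (((P.L : ℝ) ^ k - 1) * (P.L : ℝ) ^ k) * P.d * T ^ 2 + 2 * (P.d * ((P.L : ℝ) ^ k - 1) * T) ^ 2 ≤ 1 / 2 →
          ∀ x y : Balaban1983to89.Site P 0,
            ‖gBox (B1RG242Torus.α P a k * (P.L : ℝ) ^ (k * P.d)) P.eps⁻¹ U k Ω x y‖ ≤
              c₀ * P.spacing k ^ 2 * Real.exp (-(t₀ * (supDist x y : ℝ) / (P.L : ℝ) ^ k)) := by
  obtain ⟨t₀, c₀, ht₀, hc₀, H⟩ := decay_kernel_smoothNear_region d ha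
  refine ⟨t₀, c₀, ht₀, hc₀, ?_⟩
  intro P hPd k hk1 hk hR Ω hΩ U ek η C pek hek hCp X B Pl hS hPl hB T hT hsmall x y
  exact H P hPd k hk1 hk hR Ω hΩ U (ek * η ^ 2 * (C * pek)) (by positivity) (plaqSmall_near_of_smoothOn hek hS hPl hB) T hT hsmall x y

/-- **[6] (1.10) COVARIANT-DERIVATIVE KERNEL MEMBER UNDER THE PRINTED (2.32) NEAR `Ω`**, same data, every `b ∈ Ω*`, every `y`.
[cite: BalabanImbrieJaffe1988, (2.30)–(2.32) p.263, Claim p.263] [cite: Balaban1983RegularityDecay, Theorem p.573 (1.10)] -/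
theorem decay_covD_kernel_smoothOn_region (d : ℕ) {a : ℝ} (ha : 0 < a) :
    ∃ t₀ c₁ : ℝ, 0 < t₀ ∧ 0 < c₁ ∧ ∀ (P : Params), P.d = d →
      ∀ k : ℕ, 1 ≤ k → k ≤ P.m + P.K → 2 * (P.L ^ k - 1) + 4 < P.sitesPerDir 0 →
      ∀ (Ω : Finset (Balaban1983to89.Site P 0)), IsBlockUnion k Ω →
      ∀ (U : GaugeField P 0 U1) (ek η C pek : ℝ), 0 ≤ ek → 0 ≤ C * pek →
      ∀ (X : Finset (Balaban1983to89.Site P 0)) (B : Finset (PBond P 0)) (Pl : Finset (Balaban1983to89.Plaq P 0)),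
        SmoothOn ek η C pek X B Pl (cfg U) →
        (∀ p : Balaban1983to89.Plaq P 0, (∃ y ∈ Ω, supDist y p.src ≤ 2 * P.L ^ k) → p ∈ Pl) →
        (∀ p ∈ Pl, (⟨p.src, p.μ⟩ : PBond P 0) ∈ B ∧ (⟨p.src.shift p.μ, p.ν⟩ : PBond P 0) ∈ B ∧
          (⟨p.src.shift p.ν, p.μ⟩ : PBond P 0) ∈ B ∧ (⟨p.src, p.ν⟩ : PBond P 0) ∈ B) →
        ∀ (T : ℝ), ((P.d - 1 : ℕ) : ℝ) * ((P.L : ℝ) ^ k - 1) * (ek * η ^ 2 * (C * pek)) ≤ T →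
          2 * (((P.L : ℝ) ^ k - 1) * (P.L : ℝ) ^ k) * P.d * T ^ 2 + 2 * (P.d * ((P.L : ℝ) ^ k - 1) * T) ^ 2 ≤ 1 / 2 →
          ∀ b ∈ starB Ω, ∀ y : Balaban1983to89.Site P 0,
            ‖covD P.eps⁻¹ (cfg U) (fun x => gBox (B1RG242Torus.α P a k * (P.L : ℝ) ^ (k * P.d)) P.eps⁻¹ U k Ω x y) b‖ ≤
              c₁ * P.spacing k * Real.exp (-(t₀ * (supDist y b.tgt : ℝ) / (P.L : ℝ) ^ k)) := by
  obtain ⟨t₀, c₁, ht₀, hc₁, H⟩ := decay_covD_kernel_smoothNear_region d ha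
  refine ⟨t₀, c₁, ht₀, hc₁, ?_⟩
  intro P hPd k hk1 hk hR Ω hΩ U ek η C pek hek hCp X B Pl hS hPl hB T hT hsmall b hb y
  exact H P hPd k hk1 hk hR Ω hΩ U (ek * η ^ 2 * (C * pek)) (by positivity) (plaqSmall_near_of_smoothOn hek hS hPl hB) T hT hsmall b hb y

/-- **[6] (1.10) OPERATOR-FORM VALUE MEMBER UNDER THE PRINTED (2.32) NEAR `Ω`**, `P.d = d+1 ≤ 3`, `L = ℓ+1`, every `x`, (H1.10)-input shape:
`‖(G_k(Ω,u)f)(x)‖ ≤ (L^kε)²·c₀e^{−δ₀D/L^k}‖f‖_∞` — (2.30) for the region propagators under their PRINTED hypothesis.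
[cite: BalabanImbrieJaffe1988, (2.30)–(2.32) p.263] [cite: Balaban1983RegularityDecay, Theorem p.573 (1.10)] -/
theorem decay110_smoothOn_region (d ℓ : ℕ) (hd3 : d + 1 ≤ 3) (hℓ : 1 ≤ ℓ) {a : ℝ} (ha : 0 < a) :
    ∃ δ₀ c₀ : ℝ, 0 < δ₀ ∧ 0 < c₀ ∧ ∀ (P : Params), P.d = d + 1 → P.L = ℓ + 1 →
      ∀ k : ℕ, 1 ≤ k → k ≤ P.m + P.K → 2 * (P.L ^ k - 1) + 4 < P.sitesPerDir 0 →
      ∀ (Ω : Finset (Balaban1983to89.Site P 0)), IsBlockUnion k Ω →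
      ∀ (U : GaugeField P 0 U1) (ek η C pek : ℝ), 0 ≤ ek → 0 ≤ C * pek →
      ∀ (X : Finset (Balaban1983to89.Site P 0)) (B : Finset (PBond P 0)) (Pl : Finset (Balaban1983to89.Plaq P 0)),
        SmoothOn ek η C pek X B Pl (cfg U) →
        (∀ p : Balaban1983to89.Plaq P 0, (∃ y ∈ Ω, supDist y p.src ≤ 2 * P.L ^ k) → p ∈ Pl) →
        (∀ p ∈ Pl, (⟨p.src, p.μ⟩ : PBond P 0) ∈ B ∧ (⟨p.src.shift p.μ, p.ν⟩ : PBond P 0) ∈ B ∧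
          (⟨p.src.shift p.ν, p.μ⟩ : PBond P 0) ∈ B ∧ (⟨p.src, p.ν⟩ : PBond P 0) ∈ B) →
        ∀ (T : ℝ), ((P.d - 1 : ℕ) : ℝ) * ((P.L : ℝ) ^ k - 1) * (ek * η ^ 2 * (C * pek)) ≤ T →
          2 * (((P.L : ℝ) ^ k - 1) * (P.L : ℝ) ^ k) * P.d * T ^ 2 + 2 * (P.d * ((P.L : ℝ) ^ k - 1) * T) ^ 2 ≤ 1 / 2 →
          ∀ (x : Balaban1983to89.Site P 0) (f : Balaban1983to89.Site P 0 → ℂ) (F D : ℝ), (∀ y, ‖f y‖ ≤ F) →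
            (∀ y, f y ≠ 0 → D ≤ B5Ineq137Torus.T P 0 x y) →
            ‖(gBox (B1RG242Torus.α P a k * (P.L : ℝ) ^ (k * P.d)) P.eps⁻¹ U k Ω *ᵥ f) x‖
              ≤ P.spacing k ^ 2 * (c₀ * Real.exp (-(δ₀ * (((P.L : ℝ) ^ k)⁻¹ * D))) * F) := by
  obtain ⟨δ₀, c₀, hδ₀, hc₀, H⟩ := decay110_smoothNear_region d ℓ hd3 hℓ ha
  refine ⟨δ₀, c₀, hδ₀, hc₀, ?_⟩
  intro P hPd hPL k hk1 hk hR Ω hΩ U ek η C pek hek hCp X B Pl hS hPl hB T hT hsmall x f F D hF hsupp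
  exact H P hPd hPL k hk1 hk hR Ω hΩ U (ek * η ^ 2 * (C * pek)) (by positivity) (plaqSmall_near_of_smoothOn hek hS hPl hB) T hT hsmall
    x f F D hF hsupp

end Smooth

end

end Literature.MathematicalPhysics.QuantumFieldTheory.BalabanImbrieJaffe1984to88.BIJ88NeumannPropagatorSmoothNearRegion
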